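import Literature.NumberTheory.EllipticCurves.FormalGroupChordFormulaUniversalProofs
import Literature.NumberTheory.EllipticCurves.FormalGroupXDerivativeProofs
import Literature.NumberTheory.EllipticCurves.FormalGroupMultiplicationUniversalProofs
import Literature.NumberTheory.EllipticCurves.FormalGroupDictionaryProofs
import Literature.NumberTheory.EllipticCurves.FormalGroupChartUniquenessProofs
import HarnessLib

/-!
# The EVEN SQUARE LAW on the formal group: `√(X(T) − x₀T²) ∘ [2] ∈ ℤ⟦T⟧` for an integral 2-torsion point `(x₀, y₀)`
# (line `star` v19, registered stub `stub_evenSquareLaw`; crux E1M, stmt-BirchSwinnertonDyer-20341; lead star-p1 GEN 21, 2026-08-29)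

For a Weierstrass equation `V` over `ℤ` and an INTEGRAL point `(x₀, y₀) ∈ ℤ²` of order `2` (`2y₀ + a₁x₀ + a₃ = 0`), let
`B ∈ ℚ⟦T⟧`, `B(0) = 1`, `B² = X(T) − x₀T²` (`X = T²x(T) = formalXMulSq`; so `B/T = √(x − x₀)`, the Kummer function of the 2-torsion point;
`B` has unbounded `2`-power denominators when `(x₀, y₀)` is étale at `2`).  THEN `B([2]T) ∈ ℤ⟦T⟧` (`evenSquareLaw_int`).

PROOF (Silverman AEC III.2.3 + IV.2, poles cleared; pure power-series algebra over `ℤ`).  Write `D = [2]T`, `Ỹ = (a₁T − 2)X + a₃T³`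
(`= T³(2y + a₁x + a₃)`), `N = 3X² + 2a₂T²X + a₄T⁴ + a₁TX`, `M = N² + a₁NTỸ − a₂T²Ỹ² − 2XỸ²` (`M(0) = 1`).  The tree's cleared duplication
identities (`formalXMulSq_formalMul_two'`: `X(D)·T²Ỹ² = D²M`; `formalXMulSq_formalMul_twoY'`) give (1) `D·K = −M·T·Ỹ` with
`K = −N(M − XỸ²) + XỸ³ − a₁MTỸ − a₃T³Ỹ³ ∈ ℤ⟦T⟧`, `K(0) = 1`; the chart equation (`formalXMulSq_sq_eq`) and the 2-torsion relations give
(2) `M − x₀T²Ỹ² = G²`, `G = X² − 2x₀T²X + pT⁴`, `p = −a₄ − 2x₀a₂ + a₁y₀ − 2x₀² ∈ ℤ` (this is `(x(2P) − x₀)(2y + a₁x + a₃)² = g(x)²`,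
`g = x² − 2x₀x + p`, the square structure of `[2]^*(x − x₀)`); with `B(D)² = X(D) − x₀D²`: `(B(D)·K)²·T²Ỹ² = (M·G)²·T²Ỹ²`, so
`B(D)·K = M·G` (domain, constant terms `1`), i.e. `B(D) = M·G·K⁻¹ ∈ ℤ⟦T⟧`.

No `sorry`, no new definition, no named fact; nothing here reads `r_an`; E1M / BSD are NOT proved by this file.
-/

set_option linter.dupNamespace false
set_option autoImplicit false

noncomputable section

open PowerSeries WeierstrassCurve Literature.NumberTheory.EllipticCurves

namespace Summit.BirchSwinnertonDyer.BirchSwinnertonDyer.Theorems.DepletionAtTwo.EvenBranch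

/-- **The even square law (integral form).**  `V/ℤ` a Weierstrass equation, `(x₀, y₀) ∈ ℤ²` a point of order `2` on it, `B ∈ ℚ⟦T⟧` with
`B(0) = 1` and `B² = X(T) − x₀T²`: then `B([2]T)` has integer coefficients.  [cite: SilvermanAEC2009, III.2.3(d), IV.1, IV.2] -/
theorem evenSquareLaw_int (V : WeierstrassCurve ℤ) (x₀ y₀ : ℤ)
    (hT1 : y₀ ^ 2 + V.a₁ * x₀ * y₀ + V.a₃ * y₀ = x₀ ^ 3 + V.a₂ * x₀ ^ 2 + V.a₄ * x₀ + V.a₆)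
    (hT2 : 2 * y₀ + V.a₁ * x₀ + V.a₃ = 0)
    (B : PowerSeries ℚ) (hB0 : PowerSeries.constantCoeff B = 1)
    (hBsq : B ^ 2 = (V.map (Int.castRingHom ℚ)).formalXMulSq - PowerSeries.C (x₀ : ℚ) * PowerSeries.X ^ 2) :
    ∃ R : PowerSeries ℤ,
      PowerSeries.map (Int.castRingHom ℚ) R = B.subst ((V.map (Int.castRingHom ℚ)).formalMul 2) := by
  ------------------------------------------------------------------
  -- the three tree identities over `ℤ`, and names
  ------------------------------------------------------------------
  have hE1 := V.formalXMulSq_formalMul_two'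
  have hE4 := V.formalXMulSq_formalMul_twoY'
  have hCE := V.formalXMulSq_sq_eq
  have hD1 : coeff 1 (V.formalMul 2) = (2 : ℕ) := V.coeff_one_formalMul' 2
  have hD0 : constantCoeff (V.formalMul 2) = 0 := V.constantCoeff_formalMul 2
  have hXs0 : constantCoeff V.formalXMulSq = 1 := V.constantCoeff_formalXMulSq
  set Xs : ℤ⟦X⟧ := V.formalXMulSq with hXs
  set D : ℤ⟦X⟧ := V.formalMul 2 with hD
  set XD : ℤ⟦X⟧ := Xs.subst D with hXD
  set Yt : ℤ⟦X⟧ := (C V.a₁ * X - 2) * Xs + C V.a₃ * X ^ 3 with hYt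
  set N : ℤ⟦X⟧ := 3 * Xs ^ 2 + 2 * C V.a₂ * X ^ 2 * Xs + C V.a₄ * X ^ 4 + C V.a₁ * X * Xs with hN
  set M : ℤ⟦X⟧ := N ^ 2 + C V.a₁ * N * X * Yt - C V.a₂ * X ^ 2 * Yt ^ 2 - 2 * Xs * Yt ^ 2 with hM
  set K : ℤ⟦X⟧ := -(N * (M - Xs * Yt ^ 2)) + Xs * Yt ^ 3 - C V.a₁ * M * X * Yt - C V.a₃ * X ^ 3 * Yt ^ 3 with hK
  set G : ℤ⟦X⟧ := Xs ^ 2 - 2 * C x₀ * X ^ 2 * Xs +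
    (-C V.a₄ - 2 * C x₀ * C V.a₂ + C V.a₁ * C y₀ - 2 * C x₀ ^ 2) * X ^ 4 with hG
  -- constant terms
  have hYt0 : constantCoeff Yt = -2 := by
    rw [hYt]
    simp only [map_add, map_mul, map_sub, map_pow, constantCoeff_C, constantCoeff_X, hXs0, map_ofNat]
    ring
  have hN0 : constantCoeff N = 3 := by
    rw [hN]
    simp only [map_add, map_mul, map_pow, constantCoeff_C, constantCoeff_X, hXs0, map_ofNat]
    ring
  have hM0 : constantCoeff M = 1 := by
    rw [hM]
    simp only [map_add, map_mul, map_sub, map_pow, constantCoeff_C, constantCoeff_X, hXs0, hYt0, hN0, map_ofNat]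
    ring
  have hK0 : constantCoeff K = 1 := by
    rw [hK]
    simp only [map_add, map_mul, map_sub, map_neg, map_pow, constantCoeff_C, constantCoeff_X, hXs0, hYt0, hN0, hM0]
    ring
  have hG0 : constantCoeff G = 1 := by
    rw [hG]
    simp only [map_add, map_mul, map_sub, map_neg, map_pow, constantCoeff_C, constantCoeff_X, hXs0, map_ofNat]
    ring
  ------------------------------------------------------------------
  -- (1) `D·K = −M·T·Ỹ`
  ------------------------------------------------------------------
  have h1 : (M * X * Yt + D * K) * D ^ 2 = 0 := by
    linear_combination (-(Yt ^ 2)) * hE4 + (-(X * Yt) + C V.a₁ * D * X * Yt + N * D) * hE1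
  have hDne : D ≠ 0 := fun h ↦ by
    rw [h, map_zero] at hD1
    norm_num at hD1
  have hKid : D * K = -(M * X * Yt) := by
    rcases mul_eq_zero.mp h1 with h | h
    · linear_combination h
    · exact absurd ((pow_eq_zero_iff two_ne_zero).mp h) hDne
  ------------------------------------------------------------------
  -- (2) the square completion `M − x₀T²Ỹ² = G²` (chart equation + 2-torsion relations)
  ------------------------------------------------------------------
  have hT1' : C y₀ ^ 2 + C V.a₁ * C x₀ * C y₀ + C V.a₃ * C y₀ =
      C x₀ ^ 3 + C V.a₂ * C x₀ ^ 2 + C V.a₄ * C x₀ + (C V.a₆ : ℤ⟦X⟧) := by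
    have h := congrArg (C : ℤ →+* ℤ⟦X⟧) hT1
    simpa only [map_add, map_mul, map_pow] using h
  have hT2' : 2 * C y₀ + C V.a₁ * C x₀ + C V.a₃ = (0 : ℤ⟦X⟧) := by
    have h := congrArg (C : ℤ →+* ℤ⟦X⟧) hT2
    simpa only [map_add, map_mul, map_ofNat, map_zero] using h
  have hGsq : M - C x₀ * X ^ 2 * Yt ^ 2 = G ^ 2 := by
    linear_combination (-(C V.a₁) ^ 2 * X ^ 2 - 4 * (C V.a₂) * X ^ 2 - 8 * Xs - 4 * X ^ 2 * (C x₀)) * hCE +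
      ((C V.a₁) ^ 2 * X ^ 8 + 4 * (C V.a₂) * X ^ 8 + 8 * Xs * X ^ 6 + 4 * X ^ 8 * (C x₀)) * hT1' +
      (-(C V.a₁) ^ 2 * X ^ 8 * (C y₀) + (C V.a₁) * (C V.a₂) * X ^ 8 * (C x₀) + (C V.a₁) * (C V.a₄) * X ^ 8 -
        (C V.a₁) * Xs ^ 2 * X ^ 4 + (C V.a₁) * X ^ 8 * (C x₀) ^ 2 - (C V.a₂) * (C V.a₃) * X ^ 8 -
        2 * (C V.a₂) * X ^ 8 * (C y₀) - 2 * (C V.a₃) * Xs * X ^ 6 - (C V.a₃) * X ^ 8 * (C x₀) - 4 * Xs * X ^ 6 * (C y₀) -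
        2 * X ^ 8 * (C x₀) * (C y₀)) * hT2'
  ------------------------------------------------------------------
  -- (3) pass to `ℚ⟦T⟧`
  ------------------------------------------------------------------
  set ι : ℤ →+* ℚ := Int.castRingHom ℚ with hι
  have hsD : HasSubst D := HasSubst.of_constantCoeff_zero' hD0
  have hDQ0 : constantCoeff ((V.map ι).formalMul 2) = 0 := (V.map ι).constantCoeff_formalMul 2
  have hsDQ : HasSubst ((V.map ι).formalMul 2) := HasSubst.of_constantCoeff_zero' hDQ0
  have hιXs : PowerSeries.map ι Xs = (V.map ι).formalXMulSq := V.map_formalXMulSq ι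
  have hιD : PowerSeries.map ι D = (V.map ι).formalMul 2 := V.map_formalMul ι 2
  have hιXD : PowerSeries.map ι XD = (V.map ι).formalXMulSq.subst ((V.map ι).formalMul 2) := by
    rw [hXD, WeierstrassCurve.powerSeries_map_subst ι hsD, hιXs, hιD]
  -- `B(D)² = X(D) − x₀D²`
  have hBDsq : (B.subst ((V.map ι).formalMul 2)) ^ 2 =
      PowerSeries.map ι XD - C (x₀ : ℚ) * (PowerSeries.map ι D) ^ 2 := by
    have h := congrArg (PowerSeries.subst ((V.map ι).formalMul 2)) hBsq
    rw [← coe_substAlgHom hsDQ, map_pow, map_sub, map_mul, map_pow, coe_substAlgHom, subst_X hsDQ,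
      Literature.NumberTheory.EllipticCurves.C_subst] at h
    rw [h, hιXD, hιD]
  set BD : ℚ⟦X⟧ := B.subst ((V.map ι).formalMul 2) with hBD
  set Dq : ℚ⟦X⟧ := PowerSeries.map ι D with hDq
  set XDq : ℚ⟦X⟧ := PowerSeries.map ι XD with hXDq
  set Yq : ℚ⟦X⟧ := PowerSeries.map ι Yt with hYq
  set Mq : ℚ⟦X⟧ := PowerSeries.map ι M with hMq
  set Kq : ℚ⟦X⟧ := PowerSeries.map ι K with hKq
  set Gq : ℚ⟦X⟧ := PowerSeries.map ι G with hGq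
  -- the identities, mapped
  have hE1q : XDq * X ^ 2 * Yq ^ 2 = Dq ^ 2 * Mq := by
    have h := congrArg (PowerSeries.map ι) hE1
    simpa only [map_mul, map_pow, PowerSeries.map_X] using h
  have hKq' : Dq * Kq = -(Mq * X * Yq) := by
    have h := congrArg (PowerSeries.map ι) hKid
    simpa only [map_mul, map_neg, PowerSeries.map_X] using h
  have hGq' : Mq - C (x₀ : ℚ) * X ^ 2 * Yq ^ 2 = Gq ^ 2 := by
    have h := congrArg (PowerSeries.map ι) hGsq
    simpa only [map_sub, map_mul, map_pow, PowerSeries.map_C, PowerSeries.map_X, eq_intCast ι] using h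
  ------------------------------------------------------------------
  -- (4) `(B(D)·K)² = (M·G)²`, hence `B(D)·K = M·G`
  ------------------------------------------------------------------
  have h6 : (BD * Kq) ^ 2 * (X * Yq) ^ 2 = (Mq * Gq) ^ 2 * (X * Yq) ^ 2 := by
    linear_combination (Kq ^ 2 * X ^ 2 * Yq ^ 2) * hBDsq + Kq ^ 2 * hE1q + (Dq ^ 2 * Kq ^ 2) * hGq' +
      ((Dq * Kq - Mq * X * Yq) * Gq ^ 2) * hKq'
  have hYq0 : constantCoeff Yq = -2 := by
    rw [hYq, ← coeff_zero_eq_constantCoeff_apply, coeff_map, coeff_zero_eq_constantCoeff_apply, hYt0]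
    simp
  have hXY : (X : ℚ⟦X⟧) * Yq ≠ 0 := by
    refine mul_ne_zero X_ne_zero fun h ↦ ?_
    rw [h, map_zero] at hYq0
    norm_num at hYq0
  have h7 : (BD * Kq) ^ 2 = (Mq * Gq) ^ 2 := mul_right_cancel₀ (pow_ne_zero 2 hXY) h6
  have hBD0 : constantCoeff BD = 1 := by
    rw [hBD, WeierstrassCurve.constantCoeff_subst_eq_constantCoeff hDQ0, hB0]
  have hKq0 : constantCoeff Kq = 1 := by
    rw [hKq, ← coeff_zero_eq_constantCoeff_apply, coeff_map, coeff_zero_eq_constantCoeff_apply, hK0, map_one]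
  have hMq0 : constantCoeff Mq = 1 := by
    rw [hMq, ← coeff_zero_eq_constantCoeff_apply, coeff_map, coeff_zero_eq_constantCoeff_apply, hM0, map_one]
  have hGq0 : constantCoeff Gq = 1 := by
    rw [hGq, ← coeff_zero_eq_constantCoeff_apply, coeff_map, coeff_zero_eq_constantCoeff_apply, hG0, map_one]
  have h9 : BD * Kq = Mq * Gq := by
    rcases eq_or_eq_neg_of_sq_eq_sq _ _ h7 with h | h
    · exact h
    · exfalso
      have hc := congrArg constantCoeff h
      rw [map_mul, map_neg, map_mul, hBD0, hKq0, hMq0, hGq0] at hc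
      norm_num at hc
  ------------------------------------------------------------------
  -- (5) the integer series `R = M·G·K⁻¹`
  ------------------------------------------------------------------
  have hKinv : K * K.invOfUnit 1 = 1 := mul_invOfUnit K 1 (by rw [hK0, Units.val_one])
  refine ⟨M * G * K.invOfUnit 1, ?_⟩
  calc PowerSeries.map ι (M * G * K.invOfUnit 1)
      = Mq * Gq * PowerSeries.map ι (K.invOfUnit 1) := by rw [map_mul, map_mul]
    _ = BD * (PowerSeries.map ι (K * K.invOfUnit 1)) := by rw [← h9, map_mul]; ring
    _ = BD := by rw [hKinv, map_one, mul_one]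

end Summit.BirchSwinnertonDyer.BirchSwinnertonDyer.Theorems.DepletionAtTwo.EvenBranch

end
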